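import Mathlib
import HarnessLib

/-!
# BalabanIR engine `BirComplexStableXY` (stmt-HubbardSuperconductivity-2080): periodic cube
integrals, translation invariance and the one-spin shear

Support lemmas for crux 2 of route BalabanIR (`--supports stmt-HubbardSuperconductivity-2080`),
companion of `BalabanIRBirComplexStableXYFixedVolumeLaplace.lean`.  The typed partition function
is an integral over the cube `[0,2π]^Λ` of a function which is `2π`-periodic in every coordinate
and invariant under the global rotation `θ ↦ θ + α·1`.  This file supplies, abstractly for a
finite index type `ι` and a period `p > 0`:

* the coordinatewise covering map `(ι → ℝ) → (ι → AddCircle p)` is measure preserving from the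
  half-open cube `∏ (t, t+p]` (`birTorus_measurePreserving_mk`, from `AddCircle.measurePreserving_mk`
  and `measurePreserving_pi`), so the cube integral of a periodic function is an integral over the
  torus (`birTorus_setIntegral_eq`), independent of `t` (`birTorus_setIntegral_indep`) and
  invariant under translations (`birTorus_setIntegral_add`);
* the lift of a periodic function to the torus (`birTorus_exists_lift`).

No definitions.
-/

namespace Summit.HubbardSuperconductivity.HubbardSuperconductivity.Theorems

open scoped BigOperators
open MeasureTheory Set

section Torus

variable {ι : Type*} [Fintype ι] {p : ℝ} [hp : Fact (0 < p)]

/-- The coordinatewise covering map to the torus `(AddCircle p)^ι` is measure preserving from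
the half-open cube `∏_i (t, t + p]` with Lebesgue measure to the Haar measure `volume`. -/
theorem birTorus_measurePreserving_mk (t : ℝ) :
    MeasurePreserving (fun (θ : ι → ℝ) (i : ι) => ((θ i : ℝ) : AddCircle p))
      ((volume : Measure (ι → ℝ)).restrict (Set.pi univ fun _ : ι => Ioc t (t + p)))
      (volume : Measure (ι → AddCircle p)) := by
  have h := measurePreserving_pi (fun _ : ι => (volume : Measure ℝ).restrict (Ioc t (t + p)))
    (fun _ : ι => (volume : Measure (AddCircle p)))
    (f := fun _ (x : ℝ) => (x : AddCircle p)) (fun _ => AddCircle.measurePreserving_mk p t)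
  rw [← Measure.restrict_pi_pi] at h
  simpa only [volume_pi] using h

/-- Cube integral of a lifted function = torus integral. -/
theorem birTorus_setIntegral_lift (t : ℝ) {Ψt : (ι → AddCircle p) → ℂ} (hm : Measurable Ψt) :
    ∫ θ in Set.pi univ (fun _ : ι => Ioc t (t + p)), Ψt (fun i => ((θ i : ℝ) : AddCircle p))
      = ∫ x, Ψt x := by
  have h := birTorus_measurePreserving_mk (ι := ι) (p := p) t
  rw [← h.map_eq, integral_map h.measurable.aemeasurable hm.aestronglyMeasurable]

/-- Every continuous function which is `p`-periodic in each coordinate lifts to a measurable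
function on the torus. -/
theorem birTorus_exists_lift {Ψ : (ι → ℝ) → ℂ} (hΨ : Continuous Ψ)
    (hper : ∀ (θ : ι → ℝ) (k : ι → ℤ), Ψ (fun i => θ i + k i • p) = Ψ θ) :
    ∃ Ψt : (ι → AddCircle p) → ℂ, Measurable Ψt ∧
      ∀ θ : ι → ℝ, Ψt (fun i => ((θ i : ℝ) : AddCircle p)) = Ψ θ := by
  refine ⟨fun x => Ψ (fun i => ((AddCircle.equivIco p 0 (x i) : ℝ))), ?_, ?_⟩
  · refine hΨ.measurable.comp (measurable_pi_iff.2 fun i => ?_)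
    exact measurable_subtype_coe.comp
      ((AddCircle.measurableEquivIco p 0).measurable.comp (measurable_pi_apply i))
  · intro θ
    have hk : ∀ i, ∃ k : ℤ, ((AddCircle.equivIco p 0 ((θ i : ℝ) : AddCircle p) : ℝ)) = θ i + k • p := by
      intro i
      have h1 : (((AddCircle.equivIco p 0 ((θ i : ℝ) : AddCircle p) : ℝ)) : AddCircle p)
          = ((θ i : ℝ) : AddCircle p) := AddCircle.coe_equivIco
      have h2 : ((((AddCircle.equivIco p 0 ((θ i : ℝ) : AddCircle p) : ℝ)) - θ i : ℝ) : AddCircle p)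
          = 0 := by
        rw [AddCircle.coe_sub, h1, sub_self]
      obtain ⟨n, hn⟩ := (AddCircle.coe_eq_zero_iff p).1 h2
      exact ⟨n, by linarith⟩
    choose k hk using hk
    have : (fun i => ((AddCircle.equivIco p 0 ((θ i : ℝ) : AddCircle p) : ℝ))) = fun i => θ i + k i • p :=
      funext hk
    show Ψ (fun i => ((AddCircle.equivIco p 0 ((θ i : ℝ) : AddCircle p) : ℝ))) = Ψ θ
    rw [this, hper]

/-- The cube integral of a continuous periodic function is a torus integral of its lift. -/
theorem birTorus_setIntegral_eq (t : ℝ) {Ψ : (ι → ℝ) → ℂ} {Ψt : (ι → AddCircle p) → ℂ}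
    (hm : Measurable Ψt) (hlift : ∀ θ : ι → ℝ, Ψt (fun i => ((θ i : ℝ) : AddCircle p)) = Ψ θ) :
    ∫ θ in Set.pi univ (fun _ : ι => Ioc t (t + p)), Ψ θ = ∫ x, Ψt x := by
  rw [← birTorus_setIntegral_lift t hm]
  exact setIntegral_congr_fun (MeasurableSet.univ_pi fun _ => measurableSet_Ioc)
    fun θ _ => (hlift θ).symm

/-- The cube integral of a continuous periodic function does not depend on the position of
the half-open fundamental cube. -/
theorem birTorus_setIntegral_indep (t t' : ℝ) {Ψ : (ι → ℝ) → ℂ} (hΨ : Continuous Ψ)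
    (hper : ∀ (θ : ι → ℝ) (k : ι → ℤ), Ψ (fun i => θ i + k i • p) = Ψ θ) :
    ∫ θ in Set.pi univ (fun _ : ι => Ioc t (t + p)), Ψ θ
      = ∫ θ in Set.pi univ (fun _ : ι => Ioc t' (t' + p)), Ψ θ := by
  obtain ⟨Ψt, hm, hlift⟩ := birTorus_exists_lift hΨ hper
  rw [birTorus_setIntegral_eq t hm hlift, birTorus_setIntegral_eq t' hm hlift]

/-- **Translation invariance of periodic cube integrals**: for a continuous function which is
`p`-periodic in each coordinate and every vector `v`,
`∫_{∏(t,t+p]} Ψ (θ + v) dθ = ∫_{∏(t,t+p]} Ψ θ dθ`. -/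
theorem birTorus_setIntegral_add (t : ℝ) {Ψ : (ι → ℝ) → ℂ} (hΨ : Continuous Ψ)
    (hper : ∀ (θ : ι → ℝ) (k : ι → ℤ), Ψ (fun i => θ i + k i • p) = Ψ θ) (v : ι → ℝ) :
    ∫ θ in Set.pi univ (fun _ : ι => Ioc t (t + p)), Ψ (θ + v)
      = ∫ θ in Set.pi univ (fun _ : ι => Ioc t (t + p)), Ψ θ := by
  obtain ⟨Ψt, hm, hlift⟩ := birTorus_exists_lift hΨ hper
  -- the translate lifts to the translate
  have hm' : Measurable fun x : ι → AddCircle p => Ψt (x + fun i => ((v i : ℝ) : AddCircle p)) :=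
    hm.comp (measurable_add_const _)
  have hlift' : ∀ θ : ι → ℝ,
      (fun x : ι → AddCircle p => Ψt (x + fun i => ((v i : ℝ) : AddCircle p)))
        (fun i => ((θ i : ℝ) : AddCircle p)) = Ψ (θ + v) := by
    intro θ
    have : ((fun i => ((θ i : ℝ) : AddCircle p)) + fun i => ((v i : ℝ) : AddCircle p))
        = fun i => (((θ + v) i : ℝ) : AddCircle p) := by
      funext i
      simp only [Pi.add_apply, AddCircle.coe_add]
    show Ψt ((fun i => ((θ i : ℝ) : AddCircle p)) + fun i => ((v i : ℝ) : AddCircle p)) = Ψ (θ + v)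
    rw [this, hlift]
  rw [birTorus_setIntegral_eq t hm' hlift', birTorus_setIntegral_eq t hm hlift]
  exact integral_add_right_eq_self (μ := (volume : Measure (ι → AddCircle p))) Ψt _


omit hp in
/-- Closed and half-open fundamental cubes carry the same integrals (faces are null). -/
theorem birTorus_setIntegral_Icc_eq_Ioc (t : ℝ) (Ψ : (ι → ℝ) → ℂ) :
    ∫ θ in Set.pi univ (fun _ : ι => Icc t (t + p)), Ψ θ
      = ∫ θ in Set.pi univ (fun _ : ι => Ioc t (t + p)), Ψ θ := by
  refine setIntegral_congr_set ?_
  have h := (Measure.pi_Ioc_ae_eq_pi_Icc (μ := fun _ : ι => (volume : Measure ℝ)) (s := univ)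
    (f := fun _ : ι => t) (g := fun _ : ι => t + p))
  rw [← volume_pi] at h
  exact h.symm

omit [Fintype ι] in
/-- Continuity of the extension-by-zero map `δ ↦ (i ↦ if i = s₀ then 0 else δ i)`. -/
theorem birTorus_continuous_ext [DecidableEq ι] (s₀ : ι) :
    Continuous fun (δ : {i // i ≠ s₀} → ℝ) (i : ι) => if h : i = s₀ then (0 : ℝ) else δ ⟨i, h⟩ := by
  refine continuous_pi fun i => ?_
  by_cases h : i = s₀
  · simp only [h, dif_pos]; exact continuous_const
  · simp only [h, dif_neg, not_false_eq_true]; exact continuous_apply _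

/-- **The one-spin shear.**  For a continuous function on `ι → ℝ` which is `p`-periodic in each
coordinate and invariant under the global rotation `θ ↦ θ + α·1`, fixing the spin at `s₀`
costs exactly a factor `p`:
`∫_{∏_ι (t,t+p]} Φ = p · ∫_{∏_{ι∖s₀} (t,t+p]} Φ (ext δ) dδ`, `ext δ` the extension by `0`. -/
theorem birTorus_shear [DecidableEq ι] (s₀ : ι) (t : ℝ) {Φ : (ι → ℝ) → ℂ} (hΦ : Continuous Φ)
    (hper : ∀ (θ : ι → ℝ) (k : ι → ℤ), Φ (fun i => θ i + k i • p) = Φ θ)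
    (hrot : ∀ (θ : ι → ℝ) (α : ℝ), Φ (fun i => θ i + α) = Φ θ) :
    ∫ θ in Set.pi univ (fun _ : ι => Ioc t (t + p)), Φ θ
      = (p : ℂ) * ∫ δ in Set.pi univ (fun _ : {i // i ≠ s₀} => Ioc t (t + p)),
          Φ (fun i => if h : i = s₀ then 0 else δ ⟨i, h⟩) := by
  set ext : ({i // i ≠ s₀} → ℝ) → (ι → ℝ) :=
    fun δ i => if h : i = s₀ then 0 else δ ⟨i, h⟩ with hext
  have hext_cont : Continuous ext := birTorus_continuous_ext s₀
  set e := MeasurableEquiv.piEquivPiSubtypeProd (fun _ : ι => ℝ) (fun i => i ≠ s₀) with he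
  have hemp : MeasurePreserving e := volume_preserving_piEquivPiSubtypeProd (fun _ : ι => ℝ) _
  set cube : Set (ι → ℝ) := Set.pi univ (fun _ : ι => Ioc t (t + p)) with hcube
  set cube₁ : Set ({i // i ≠ s₀} → ℝ) := Set.pi univ (fun _ => Ioc t (t + p)) with hcube₁
  set cube₂ : Set ({i // ¬ i ≠ s₀} → ℝ) := Set.pi univ (fun _ => Ioc t (t + p)) with hcube₂
  -- the symm map, pointwise
  have hsymm : ∀ (b : {i // i ≠ s₀} → ℝ) (a : {i // ¬ i ≠ s₀} → ℝ) (i : ι),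
      e.symm (b, a) i = if h : i ≠ s₀ then b ⟨i, h⟩ else a ⟨i, h⟩ := by
    intro b a i
    rfl
  -- Step A: pull back along `e.symm`
  have hpre : e.symm ⁻¹' cube = cube₁ ×ˢ cube₂ := by
    rw [hcube, hcube₁, hcube₂]
    exact Equiv.preimage_piEquivPiSubtypeProd_symm_pi (fun i => i ≠ s₀) (fun _ : ι => Ioc t (t + p))
  have hA : ∫ θ in cube, Φ θ = ∫ z in cube₁ ×ˢ cube₂, Φ (e.symm z) := by
    rw [← hpre]
    exact (hemp.symm.setIntegral_preimage_emb e.symm.measurableEmbedding Φ cube).symm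
  -- continuity of `z ↦ Φ (e.symm z)`
  have hsymm_cont : Continuous fun z : ({i // i ≠ s₀} → ℝ) × ({i // ¬ i ≠ s₀} → ℝ) => e.symm z := by
    refine continuous_pi fun i => ?_
    by_cases h : i ≠ s₀
    · have : (fun z : ({i // i ≠ s₀} → ℝ) × ({i // ¬ i ≠ s₀} → ℝ) => e.symm z i)
          = fun z => z.1 ⟨i, h⟩ := by
        funext z; rw [hsymm, dif_pos h]
      rw [this]; fun_prop
    · have : (fun z : ({i // i ≠ s₀} → ℝ) × ({i // ¬ i ≠ s₀} → ℝ) => e.symm z i)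
          = fun z => z.2 ⟨i, h⟩ := by
        funext z; rw [hsymm, dif_neg h]
      rw [this]; fun_prop
  have hcont : Continuous fun z : ({i // i ≠ s₀} → ℝ) × ({i // ¬ i ≠ s₀} → ℝ) => Φ (e.symm z) :=
    hΦ.comp hsymm_cont
  -- Step B: Fubini (fixed spin outside)
  have hint : IntegrableOn (fun z : ({i // i ≠ s₀} → ℝ) × ({i // ¬ i ≠ s₀} → ℝ) => Φ (e.symm z))
      (cube₁ ×ˢ cube₂) ((volume : Measure ({i // i ≠ s₀} → ℝ)).prod volume) := by
    have hK : IsCompact ((Set.pi univ fun _ : {i // i ≠ s₀} => Icc t (t + p)) ×ˢ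
        (Set.pi univ fun _ : {i // ¬ i ≠ s₀} => Icc t (t + p))) :=
      (isCompact_univ_pi fun _ => isCompact_Icc).prod (isCompact_univ_pi fun _ => isCompact_Icc)
    have h1 : IntegrableOn (fun z : ({i // i ≠ s₀} → ℝ) × ({i // ¬ i ≠ s₀} → ℝ) => Φ (e.symm z))
        ((Set.pi univ fun _ : {i // i ≠ s₀} => Icc t (t + p)) ×ˢ
          (Set.pi univ fun _ : {i // ¬ i ≠ s₀} => Icc t (t + p)))
        ((volume : Measure ({i // i ≠ s₀} → ℝ)).prod volume) := by
      have := hcont.continuousOn.integrableOn_compact (μ := volume) hK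
      simpa only [Measure.volume_eq_prod] using this
    refine h1.mono_set (Set.prod_mono ?_ ?_)
    · exact Set.pi_mono fun _ _ => Ioc_subset_Icc_self
    · exact Set.pi_mono fun _ _ => Ioc_subset_Icc_self
  have hB : ∫ z in cube₁ ×ˢ cube₂, Φ (e.symm z)
      = ∫ a in cube₂, ∫ b in cube₁, Φ (e.symm (b, a)) := by
    have h2 : Integrable (fun z : ({i // i ≠ s₀} → ℝ) × ({i // ¬ i ≠ s₀} → ℝ) => Φ (e.symm z))
        (((volume : Measure ({i // i ≠ s₀} → ℝ)).restrict cube₁).prod (volume.restrict cube₂)) := by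
      rw [Measure.prod_restrict]; exact hint
    have := integral_prod_symm _ h2
    rw [Measure.prod_restrict] at this
    simpa only [Measure.volume_eq_prod] using this
  -- Step C: the inner integral does not depend on the fixed spin
  have hper' : ∀ (δ : {i // i ≠ s₀} → ℝ) (k : {i // i ≠ s₀} → ℤ),
      Φ (ext (fun j => δ j + k j • p)) = Φ (ext δ) := by
    intro δ k
    have : ext (fun j => δ j + k j • p)
        = fun i => ext δ i + (fun i => if h : i = s₀ then (0 : ℤ) else k ⟨i, h⟩) i • p := by
      funext i
      by_cases h : i = s₀
      · simp only [hext, h, dif_pos, zero_smul, add_zero]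
      · simp only [hext, h, dif_neg, not_false_eq_true]
    rw [this, hper]
  have hC : ∀ a : {i // ¬ i ≠ s₀} → ℝ,
      ∫ b in cube₁, Φ (e.symm (b, a)) = ∫ b in cube₁, Φ (ext b) := by
    intro a
    set α : ℝ := a ⟨s₀, fun h => h rfl⟩ with hα
    have hrew : ∀ b : {i // i ≠ s₀} → ℝ, Φ (e.symm (b, a)) = Φ (ext (b + fun _ => -α)) := by
      intro b
      rw [← hrot (e.symm (b, a)) (-α)]
      congr 1
      funext i
      by_cases h : i ≠ s₀
      · rw [hsymm, dif_pos h]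
        simp only [hext, h, dif_neg, not_false_eq_true, Pi.add_apply]
      · have hi : i = s₀ := not_not.1 h
        subst hi
        rw [hsymm, dif_neg h]
        simp only [hext, dif_pos, hα]
        ring
    simp_rw [hrew]
    exact birTorus_setIntegral_add t (hΦ.comp hext_cont) hper' (fun _ => -α)
  -- Step D: integrate the constant over the fixed spin
  have hD : ∫ a in cube₂, ∫ b in cube₁, Φ (e.symm (b, a))
      = (p : ℂ) * ∫ b in cube₁, Φ (ext b) := by
    simp_rw [hC]
    rw [setIntegral_const]
    have hvol : (volume : Measure ({i // ¬ i ≠ s₀} → ℝ)).real cube₂ = p := by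
      rw [hcube₂, Measure.real, Real.volume_pi_Ioc]
      simp only [Finset.prod_const, add_sub_cancel_left]
      have hcard : (Finset.univ : Finset {i // ¬ i ≠ s₀}).card = 1 := by
        rw [Finset.card_univ, Fintype.card_subtype]
        simp only [ne_eq, not_not, Finset.filter_eq', Finset.mem_univ, if_true,
          Finset.card_singleton]
      rw [hcard, pow_one, ENNReal.toReal_ofReal hp.out.le]
    rw [hvol, Complex.real_smul]
  rw [hA, hB, hD]

end Torus

end Summit.HubbardSuperconductivity.HubbardSuperconductivity.Theorems
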